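import Mathlib
import Summits.CriticalPhenomena.CardyFormulaZ2.Theorems.CardyMagicRigidityNestingRigidityUVExpMomentsCell
import Literature.NumberTheory.LFunctions.FordZetaBoundKappa12
import HarnessLib

/-!
# Crux `NestingRigidity`, line `positive-cone-weight-doubling`: one scale (chessboard independence)
# and the assembly across dyadic scales of the untilted exponential moments of the UV statistic

Crux `Summit.CriticalPhenomena.CardyFormulaZ2.Theses.CardyMagicRigidity.NestingRigidity`
(stmt-CriticalPhenomena-4835), line `positive-cone-weight-doubling`, registered helper [A]
`uvExpMoments_latticeEnsembles`.  Continuing …UVExpMomentsCell (one cell: `E e^{λ(Y − EY)} ≤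
exp(2λ²b²K²)` for `|Y| ≤ bN`, `E e^{(A+1)N} ≤ K`, `|λ|b ≤ A`; generalised Hölder for exponentials),
this file proves the two remaining abstract steps of the multi-scale bound, on an arbitrary
probability space and then on `E.P`, `E ∈ latticeEnsembles` (no lattice input, no cited fact, no
definition):

* §4 ONE SCALE (registered anchor `expMoment_centredSum_le_latticeEnsembles`): cells `i ∈ s`
  coloured by `L` chessboard classes, the cell statistics mutually independent inside each class
  (`iIndepFun`, Mathlib's `iIndepFun.mgf_sum`) and dominated as above, give
  `E e^{λ Σ_{i ∈ s}(Y_i − E Y_i)} ≤ exp(2 · #s · L · λ² b² K²)` for `L|λ|b ≤ A` (Hölder with equal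
  weights `1/L` over the dependent classes, the product formula inside each class);
* §5 ACROSS SCALES (registered anchor `expMoment_scaleSum_le_latticeEnsembles`): if
  `E e^{Z_k/w_k} ≤ e^{B_k/w_k}` for positive weights of total mass `≤ 1`, then
  `E e^{Σ_k Z_k} ≤ e^{Σ_k B_k}`.  With `#s ≍ 4^k` cells, `b ≍ 4^{-k}`, `λ = s/w_k`, `w_k = 2^{-k-1}`,
  §4 gives `B_k ≍ s² 2^{-k}`: the bound is uniform in the number of scales `≍ log₂(r/δ)`;
* §6 LOWER TAILS: for a nonnegative statistic, `E e^{−λ(Z − EZ)} ≤ exp(λ² E[Z²]/2)` (`λ ≥ 0`) — the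
  deficit fluctuations of the nonnegative pieces need only second moments, no tail input.
-/

noncomputable section

open MeasureTheory ProbabilityTheory Set Filter
open scoped Real Topology BigOperators ENNReal

namespace Summit.CriticalPhenomena.CardyFormulaZ2.Cruxes.NestingRigidity.PositiveConeWeightDoubling

open Summit.CriticalPhenomena.CardyFormulaZ2.Cruxes.NestingRigidity.RingCloudTomography

namespace UVExpMoments

variable {Ω : Type*} [MeasurableSpace Ω] {μ : Measure Ω}

/-! ## §4 One scale: chessboard classes, independence inside each class -/

/-- **Independent cells**: for a mutually independent family `Y` (over any index type) and a finite
set `s` of indices, if every `e^{λ(Y_i − E Y_i)}` is integrable with integral `≤ e^{B_i}`, then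
`E e^{λ Σ_{i ∈ s}(Y_i − E Y_i)} ≤ e^{Σ_{i ∈ s} B_i}` (`iIndepFun.mgf_sum`). -/
theorem integral_exp_centredSum_le_of_iIndepFun [IsProbabilityMeasure μ] {ι : Type*} (s : Finset ι)
    {Y : ι → Ω → ℝ} (hYm : ∀ i, Measurable (Y i)) (hind : iIndepFun Y μ) {l : ℝ} {B : ι → ℝ}
    (hB : ∀ i ∈ s, Integrable (fun ω ↦ Real.exp (l * (Y i ω - ∫ ω', Y i ω' ∂μ))) μ ∧
      ∫ ω, Real.exp (l * (Y i ω - ∫ ω', Y i ω' ∂μ)) ∂μ ≤ Real.exp (B i)) :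
    Integrable (fun ω ↦ Real.exp (l * ∑ i ∈ s, (Y i ω - ∫ ω', Y i ω' ∂μ))) μ ∧
      ∫ ω, Real.exp (l * ∑ i ∈ s, (Y i ω - ∫ ω', Y i ω' ∂μ)) ∂μ ≤ Real.exp (∑ i ∈ s, B i) := by
  set Xc : ι → Ω → ℝ := fun i ω ↦ Y i ω - ∫ ω', Y i ω' ∂μ with hXc
  have hXcm : ∀ i, Measurable (Xc i) := fun i ↦ (hYm i).sub_const _
  have hindc : iIndepFun Xc μ :=
    hind.comp (fun i y ↦ y - ∫ ω', Y i ω' ∂μ) fun i ↦ measurable_id.sub_const _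
  have hI : Integrable (fun ω ↦ Real.exp (l * (∑ i ∈ s, Xc i) ω)) μ :=
    hindc.integrable_exp_mul_sum hXcm fun i hi ↦ (hB i hi).1
  have hsum : ∀ ω, (∑ i ∈ s, Xc i) ω = ∑ i ∈ s, (Y i ω - ∫ ω', Y i ω' ∂μ) := fun ω ↦ by
    rw [Finset.sum_apply]
  simp_rw [hsum] at hI
  refine ⟨hI, ?_⟩
  have hmgf := hindc.mgf_sum hXcm s (t := l)
  simp only [ProbabilityTheory.mgf, Finset.sum_apply, hXc] at hmgf
  rw [hmgf, Real.exp_sum]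
  exact Finset.prod_le_prod (fun i _ ↦ integral_nonneg fun ω ↦ (Real.exp_pos _).le)
    fun i hi ↦ (hB i hi).2

/-- **One scale.**  Cells `i ∈ s` carry statistics `Y_i` dominated by nonnegative counts,
`|Y_i| ≤ b N_i`, with a UNIFORM exponential moment `E e^{(A+1)N_i} ≤ K`; the cells are coloured by
`L` chessboard classes (`cls`) and the `Y_i` are mutually independent inside each class.  Then for
`L|λ|b ≤ A`: `E e^{λ Σ_{i ∈ s}(Y_i − E Y_i)} ≤ exp(2 · #s · L · λ² b² K²)` (Hölder with equal weights
`1/L` over the classes, §2 in each cell at the parameter `Lλ`). -/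
theorem integral_exp_centredSum_le [IsProbabilityMeasure μ] {ι : Type*} {L : ℕ} (hL : 0 < L)
    (s : Finset ι) (cls : ι → Fin L) {Y N : ι → Ω → ℝ} {b A K l : ℝ} (hYm : ∀ i, Measurable (Y i))
    (hNm : ∀ i, Measurable (N i)) (hb : 0 ≤ b) (hdom : ∀ i ∈ s, ∀ ω, |Y i ω| ≤ b * N i ω)
    (hN0 : ∀ i ∈ s, ∀ ω, 0 ≤ N i ω)
    (hKi : ∀ i ∈ s, Integrable (fun ω ↦ Real.exp ((A + 1) * N i ω)) μ)
    (hK : ∀ i ∈ s, ∫ ω, Real.exp ((A + 1) * N i ω) ∂μ ≤ K)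
    (hind : ∀ c : Fin L, iIndepFun (fun i : {i : ι // cls i = c} ↦ Y i.1) μ)
    (hl : L * (|l| * b) ≤ A) :
    Integrable (fun ω ↦ Real.exp (l * ∑ i ∈ s, (Y i ω - ∫ ω', Y i ω' ∂μ))) μ ∧
      ∫ ω, Real.exp (l * ∑ i ∈ s, (Y i ω - ∫ ω', Y i ω' ∂μ)) ∂μ ≤
        Real.exp (2 * s.card * L * l ^ 2 * b ^ 2 * K ^ 2) := by
  classical
  have hL0 : (0 : ℝ) < L := by exact_mod_cast hL
  -- the class sums
  set S : Fin L → Ω → ℝ := fun c ω ↦ (L * l) * ∑ i ∈ s with cls i = c, (Y i ω - ∫ ω', Y i ω' ∂μ)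
    with hS
  have hSm : ∀ c ∈ (Finset.univ : Finset (Fin L)), Measurable (S c) := fun c _ ↦
    (Finset.measurable_sum _ fun i _ ↦ (hYm i).sub_const _).const_mul _
  -- per class: independence over the subtype
  have hclass : ∀ c : Fin L,
      Integrable (fun ω ↦ Real.exp (S c ω)) μ ∧
        ∫ ω, Real.exp (S c ω) ∂μ ≤
          Real.exp ((s.filter fun i ↦ cls i = c).card * (2 * (L * l) ^ 2 * b ^ 2 * K ^ 2)) := by
    intro c
    have hB : ∀ j ∈ (s.subtype fun i ↦ cls i = c),
        Integrable (fun ω ↦ Real.exp ((L * l) * (Y j.1 ω - ∫ ω', Y j.1 ω' ∂μ))) μ ∧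
          ∫ ω, Real.exp ((L * l) * (Y j.1 ω - ∫ ω', Y j.1 ω' ∂μ)) ∂μ ≤
            Real.exp (2 * (L * l) ^ 2 * b ^ 2 * K ^ 2) := by
      intro j hj
      have hjs : j.1 ∈ s := (Finset.mem_subtype.1 hj)
      exact integral_exp_centred_le (hYm j.1) (hNm j.1) hb (hdom j.1 hjs) (hN0 j.1 hjs) (hKi j.1 hjs)
        (hK j.1 hjs) (by rwa [abs_mul, Nat.abs_cast, mul_assoc])
    obtain ⟨hI, hle⟩ := integral_exp_centredSum_le_of_iIndepFun (μ := μ)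
      (s.subtype fun i ↦ cls i = c) (fun j ↦ hYm j.1) (hind c) hB
    have hsum : ∀ ω, ∑ j ∈ s.subtype (fun i ↦ cls i = c), (Y j.1 ω - ∫ ω', Y j.1 ω' ∂μ) =
        ∑ i ∈ s with cls i = c, (Y i ω - ∫ ω', Y i ω' ∂μ) := fun ω ↦
      Finset.sum_subtype_eq_sum_filter (fun i ↦ Y i ω - ∫ ω', Y i ω' ∂μ)
    simp_rw [hsum] at hI hle
    rw [Finset.sum_const, nsmul_eq_mul, Finset.card_subtype] at hle
    exact ⟨hI, hle⟩
  -- Hölder over the classes with equal weights `1/L`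
  set T : Fin L → Ω → ℝ := fun c ω ↦ l * ∑ i ∈ s with cls i = c, (Y i ω - ∫ ω', Y i ω' ∂μ) with hT
  have hTm : ∀ c ∈ (Finset.univ : Finset (Fin L)), Measurable (T c) := fun c _ ↦
    (Finset.measurable_sum _ fun i _ ↦ (hYm i).sub_const _).const_mul _
  have hTeq : ∀ c, (fun ω ↦ Real.exp (T c ω / (L : ℝ)⁻¹)) =
      fun ω ↦ Real.exp ((L * l) * ∑ i ∈ s with cls i = c, (Y i ω - ∫ ω', Y i ω' ∂μ)) := by
    intro c; funext ω; rw [hT]; dsimp only; rw [div_inv_eq_mul]; ring_nf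
  obtain ⟨hI, hle⟩ := integral_exp_sum_le (μ := μ) (Finset.univ : Finset (Fin L)) (X := T)
    (w := fun _ ↦ (L : ℝ)⁻¹) (fun _ _ ↦ inv_pos.2 hL0)
    (by rw [Finset.sum_const, Finset.card_univ, Fintype.card_fin, nsmul_eq_mul,
      mul_inv_cancel₀ hL0.ne'])
    hTm (fun c _ ↦ by rw [hTeq c]; exact (hclass c).1)
  have hsumT : ∀ ω, ∑ c, T c ω = l * ∑ i ∈ s, (Y i ω - ∫ ω', Y i ω' ∂μ) := by
    intro ω
    rw [hT]; dsimp only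
    rw [← Finset.mul_sum, Finset.sum_fiberwise_of_maps_to (g := cls) fun i _ ↦ Finset.mem_univ _]
  simp_rw [hsumT] at hI hle
  refine ⟨hI, hle.trans ?_⟩
  -- the product of the class bounds
  have hcard : ∑ c : Fin L, ((s.filter fun i ↦ cls i = c).card : ℝ) = s.card := by
    rw [Finset.card_eq_sum_card_fiberwise (f := cls) (t := Finset.univ) fun i _ ↦ Finset.mem_univ _]
    push_cast
    rfl
  calc ∏ c, (∫ ω, Real.exp (T c ω / (L : ℝ)⁻¹) ∂μ) ^ (L : ℝ)⁻¹
      ≤ ∏ c, (Real.exp ((s.filter fun i ↦ cls i = c).card * (2 * (L * l) ^ 2 * b ^ 2 * K ^ 2))) ^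
          (L : ℝ)⁻¹ := by
        refine Finset.prod_le_prod (fun c _ ↦ Real.rpow_nonneg
          (integral_nonneg fun ω ↦ (Real.exp_pos _).le) _) fun c _ ↦ ?_
        refine Real.rpow_le_rpow (integral_nonneg fun ω ↦ (Real.exp_pos _).le) ?_ (inv_pos.2 hL0).le
        rw [hTeq c]
        exact (hclass c).2
    _ = Real.exp (2 * s.card * L * l ^ 2 * b ^ 2 * K ^ 2) := by
        simp_rw [← Real.exp_mul]
        rw [← Real.exp_sum, ← Finset.sum_mul, ← Finset.sum_mul, hcard]
        congr 1
        field_simp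

/-! ## §5 Across scales: geometric weights -/

/-- **Across scales.**  If the scale statistics `Z_k`, `k ∈ s`, satisfy `E e^{Z_k/w_k} ≤ e^{B_k/w_k}`
for positive weights of total mass `≤ 1`, then `e^{Σ_k Z_k}` is integrable and
`E e^{Σ_{k ∈ s} Z_k} ≤ e^{Σ_{k ∈ s} B_k}` (generalised Hölder, §3).  In the application
`Z_k = s·(centred scale-k statistic)`, `w_k = 2^{−k−1}`, and §4 gives `B_k ≍ 4^{−k}/w_k ≍ 2^{−k}`. -/
theorem integral_exp_scaleSum_le [IsProbabilityMeasure μ] {ι : Type*} (s : Finset ι) {Z : ι → Ω → ℝ}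
    {w B : ι → ℝ} (hZm : ∀ k ∈ s, Measurable (Z k)) (hw0 : ∀ k ∈ s, 0 < w k)
    (hw1 : ∑ k ∈ s, w k ≤ 1)
    (hB : ∀ k ∈ s, Integrable (fun ω ↦ Real.exp (Z k ω / w k)) μ ∧
      ∫ ω, Real.exp (Z k ω / w k) ∂μ ≤ Real.exp (B k / w k)) :
    Integrable (fun ω ↦ Real.exp (∑ k ∈ s, Z k ω)) μ ∧
      ∫ ω, Real.exp (∑ k ∈ s, Z k ω) ∂μ ≤ Real.exp (∑ k ∈ s, B k) := by
  obtain ⟨hI, hle⟩ := integral_exp_sum_le (μ := μ) s hw0 hw1 hZm fun k hk ↦ (hB k hk).1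
  refine ⟨hI, hle.trans ?_⟩
  calc ∏ k ∈ s, (∫ ω, Real.exp (Z k ω / w k) ∂μ) ^ w k
      ≤ ∏ k ∈ s, Real.exp (B k / w k) ^ w k :=
        Finset.prod_le_prod (fun k _ ↦ Real.rpow_nonneg (integral_nonneg fun ω ↦ (Real.exp_pos _).le) _)
          fun k hk ↦ Real.rpow_le_rpow (integral_nonneg fun ω ↦ (Real.exp_pos _).le) (hB k hk).2
            (hw0 k hk).le
    _ = Real.exp (∑ k ∈ s, B k) := by
        rw [Real.exp_sum]
        refine Finset.prod_congr rfl fun k hk ↦ ?_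
        rw [← Real.exp_mul, div_mul_cancel₀ _ (hw0 k hk).ne']

/-! ## §6 Lower tails of nonnegative statistics need only second moments -/

/-- **Lower tail from the second moment.**  For a nonnegative statistic `Z` with `E Z² < ∞` and
`λ ≥ 0`: `E e^{−λ(Z − EZ)} ≤ exp(λ² E[Z²]/2)` (`e^{−λZ} ≤ 1 − λZ + λ²Z²/2`, the tree's
`FordVK.exp_neg_le_taylor2`, and `1 + x ≤ e^x`).  So the
one-sided (deficit) fluctuations of the nonnegative multi-scale pieces of the UV statistic need no
exponential tail input at all, only second moments of the loop counts. -/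
theorem integral_exp_neg_centred_le [IsProbabilityMeasure μ] {Z : Ω → ℝ} (hZm : Measurable Z)
    (hZ0 : ∀ ω, 0 ≤ Z ω) (hZ2 : Integrable (fun ω ↦ Z ω ^ 2) μ) {l : ℝ} (hl : 0 ≤ l) :
    Integrable (fun ω ↦ Real.exp (-(l * (Z ω - ∫ ω', Z ω' ∂μ)))) μ ∧
      ∫ ω, Real.exp (-(l * (Z ω - ∫ ω', Z ω' ∂μ))) ∂μ ≤
        Real.exp (l ^ 2 / 2 * ∫ ω, Z ω ^ 2 ∂μ) := by
  have hg : Integrable (fun ω ↦ (1 : ℝ) + Z ω ^ 2) μ := (integrable_const _).add hZ2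
  have hZi : Integrable Z μ :=
    hg.mono' hZm.aestronglyMeasurable (Eventually.of_forall fun ω ↦ by
      rw [Real.norm_eq_abs, abs_of_nonneg (hZ0 ω)]
      nlinarith [hZ0 ω, sq_nonneg (Z ω - 1)])
  set m : ℝ := ∫ ω, Z ω ∂μ with hm
  -- `e^{-λ Z}` is bounded by `1`, hence integrable, with mean `≤ 1 − λ m + λ² E Z²/2`
  have hbi : Integrable (fun ω ↦ Real.exp (-(l * Z ω))) μ :=
    Integrable.of_bound ((Real.measurable_exp.comp (hZm.const_mul l).neg).aestronglyMeasurable) 1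
      (Eventually.of_forall fun ω ↦ by
        rw [Real.norm_eq_abs, abs_of_pos (Real.exp_pos _), Real.exp_le_one_iff, neg_nonpos]
        exact mul_nonneg hl (hZ0 ω))
  have hmean : ∫ ω, Real.exp (-(l * Z ω)) ∂μ ≤ 1 - l * m + l ^ 2 / 2 * ∫ ω, Z ω ^ 2 ∂μ := by
    have i1 : Integrable (fun ω ↦ (1 : ℝ) - l * Z ω) μ := (integrable_const _).sub (hZi.const_mul l)
    have i2 : Integrable (fun ω ↦ l ^ 2 / 2 * Z ω ^ 2) μ := hZ2.const_mul _
    have hmaj : Integrable (fun ω ↦ (1 - l * Z ω) + l ^ 2 / 2 * Z ω ^ 2) μ := i1.add i2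
    calc ∫ ω, Real.exp (-(l * Z ω)) ∂μ ≤ ∫ ω, ((1 - l * Z ω) + l ^ 2 / 2 * Z ω ^ 2) ∂μ :=
          integral_mono hbi hmaj fun ω ↦ by
            have := Literature.NumberTheory.LFunctions.FordVK.exp_neg_le_taylor2 (mul_nonneg hl (hZ0 ω))
            dsimp only
            nlinarith [this]
      _ = (∫ ω, (1 - l * Z ω) ∂μ) + ∫ ω, l ^ 2 / 2 * Z ω ^ 2 ∂μ := integral_add i1 i2
      _ = 1 - l * m + l ^ 2 / 2 * ∫ ω, Z ω ^ 2 ∂μ := by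
          rw [integral_sub (integrable_const _) (hZi.const_mul l), integral_const, probReal_univ,
            one_smul, integral_const_mul, integral_const_mul]
  -- shift by the mean
  have heq : (fun ω ↦ Real.exp (-(l * (Z ω - m)))) = fun ω ↦ Real.exp (l * m) * Real.exp (-(l * Z ω)) := by
    funext ω; rw [← Real.exp_add]; ring_nf
  rw [heq]
  refine ⟨hbi.const_mul _, ?_⟩
  rw [integral_const_mul]
  calc Real.exp (l * m) * ∫ ω, Real.exp (-(l * Z ω)) ∂μ
      ≤ Real.exp (l * m) * (1 - l * m + l ^ 2 / 2 * ∫ ω, Z ω ^ 2 ∂μ) :=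
        mul_le_mul_of_nonneg_left hmean (Real.exp_pos _).le
    _ ≤ Real.exp (l * m) * Real.exp (-(l * m) + l ^ 2 / 2 * ∫ ω, Z ω ^ 2 ∂μ) := by
        refine mul_le_mul_of_nonneg_left ?_ (Real.exp_pos _).le
        linarith [Real.add_one_le_exp (-(l * m) + l ^ 2 / 2 * ∫ ω, Z ω ^ 2 ∂μ)]
    _ = Real.exp (l ^ 2 / 2 * ∫ ω, Z ω ^ 2 ∂μ) := by rw [← Real.exp_add]; ring_nf

end UVExpMoments

/-! ## The two assembly steps on the lattice ensembles (registered anchors) -/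

/-- **One scale of the multi-scale bound behind [A] `uvExpMoments_latticeEnsembles`, on both lattice
ensembles** (registered helper, line `positive-cone-weight-doubling`): cell statistics `Y_i`
(`i ∈ s`) dominated by nonnegative loop counts, `|Y_i| ≤ b N_i`, with a uniform exponential moment
`E_δ e^{(A+1)N_i} ≤ K`, coloured by `L` chessboard classes inside each of which the `Y_i` are
mutually independent under `E.P`, have `E_δ e^{λ Σ_{i ∈ s}(Y_i − E_δ Y_i)} ≤ exp(2·#s·L·λ²b²K²)`
whenever `L|λ|b ≤ A` — a centred bound quadratic in `λ`, summable over the dyadic scales. -/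
theorem expMoment_centredSum_le_latticeEnsembles : ∀ E ∈ latticeEnsembles, ∀ (ι : Type) (L : ℕ)
    (s : Finset ι) (cls : ι → Fin L) (Y N : ι → E.Ω → ℝ) (b A K l : ℝ), 0 < L →
    (∀ i, Measurable (Y i)) → (∀ i, Measurable (N i)) → 0 ≤ b →
    (∀ i ∈ s, ∀ ω, |Y i ω| ≤ b * N i ω) → (∀ i ∈ s, ∀ ω, 0 ≤ N i ω) →
    (∀ i ∈ s, Integrable (fun ω ↦ Real.exp ((A + 1) * N i ω)) E.P ∧
      ∫ ω, Real.exp ((A + 1) * N i ω) ∂E.P ≤ K) →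
    (∀ c : Fin L, ProbabilityTheory.iIndepFun (fun i : {i : ι // cls i = c} ↦ Y i.1) E.P) →
    L * (|l| * b) ≤ A →
    Integrable (fun ω ↦ Real.exp (l * ∑ i ∈ s, (Y i ω - ∫ ω', Y i ω' ∂E.P))) E.P ∧
      ∫ ω, Real.exp (l * ∑ i ∈ s, (Y i ω - ∫ ω', Y i ω' ∂E.P)) ∂E.P ≤
        Real.exp (2 * s.card * L * l ^ 2 * b ^ 2 * K ^ 2) := by
  intro E hE ι L s cls Y N b A K l hL hYm hNm hb hdom hN0 hK hind hl
  haveI := isProbabilityMeasure_of_mem hE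
  exact UVExpMoments.integral_exp_centredSum_le hL s cls hYm hNm hb hdom hN0 (fun i hi ↦ (hK i hi).1)
    (fun i hi ↦ (hK i hi).2) hind hl

/-- **The assembly across scales behind [A] `uvExpMoments_latticeEnsembles`, on both lattice
ensembles** (registered helper, line `positive-cone-weight-doubling`): if the scale statistics `Z_k`,
`k < n`, have `E_δ e^{Z_k/w_k} ≤ e^{B_k/w_k}` for positive weights `w_k` of total mass `≤ 1`, then
`E_δ e^{Σ_{k<n} Z_k} ≤ e^{Σ_{k<n} B_k}` (generalised Hölder); with `w_k = 2^{−k−1}` and the scale bound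
`B_k = O(2^{−k})` of `expMoment_centredSum_le_latticeEnsembles` the right side is uniform in the
number of scales `n ≍ log₂(r/δ)`. -/
theorem expMoment_scaleSum_le_latticeEnsembles : ∀ E ∈ latticeEnsembles, ∀ (n : ℕ) (Z : ℕ → E.Ω → ℝ)
    (w B : ℕ → ℝ), (∀ k ∈ Finset.range n, Measurable (Z k)) → (∀ k ∈ Finset.range n, 0 < w k) →
    ∑ k ∈ Finset.range n, w k ≤ 1 →
    (∀ k ∈ Finset.range n, Integrable (fun ω ↦ Real.exp (Z k ω / w k)) E.P ∧
      ∫ ω, Real.exp (Z k ω / w k) ∂E.P ≤ Real.exp (B k / w k)) →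
    Integrable (fun ω ↦ Real.exp (∑ k ∈ Finset.range n, Z k ω)) E.P ∧
      ∫ ω, Real.exp (∑ k ∈ Finset.range n, Z k ω) ∂E.P ≤ Real.exp (∑ k ∈ Finset.range n, B k) := by
  intro E hE n Z w B hZm hw0 hw1 hB
  haveI := isProbabilityMeasure_of_mem hE
  exact UVExpMoments.integral_exp_scaleSum_le (Finset.range n) hZm hw0 hw1 hB



end Summit.CriticalPhenomena.CardyFormulaZ2.Cruxes.NestingRigidity.PositiveConeWeightDoubling

end
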